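import Mathlib.Analysis.SpecialFunctions.Pow.Complex
import Mathlib.Analysis.SpecialFunctions.Pow.NNReal
import Literature.NumberTheory.Automorphic.IdeleClassGroupProofs
import Literature.NumberTheory.Automorphic.IdeleClassGroupCompactProofs
import Literature.NumberTheory.Automorphic.GLnCuspidalSpectrumSiegel
import Literature.NumberTheory.Automorphic.UnramifiedHeckeScalarsProofs
import Literature.NumberTheory.GaloisRepresentations.GaloisRep
import Literature.NumberTheory.GaloisRepresentations.UnitIdeles
import HarnessLib

/-!
# `⋂ {open finite-index subgroups of C_K} ⊆ ⋂ₙ C_Kⁿ` (Neukirch III (7.12), first half, proved)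

Topic `NumberTheory/Automorphic` (the idele class group `C_K = 𝕀_K ⧸ Kˣ`, `IdeleClassGroup K`,
`K : Type`); namespace `Literature.NumberTheory.Automorphic`.  Proof file, no definitions.

J. Neukirch, *Class Field Theory — The Bonn Lectures*, Part III, Thm. (7.12): the kernel
`D_K = ⋂_L N_{L|K} C_L` of the universal norm residue symbol is the group of infinitely divisible
idele classes, `D_K = ⋂ₙ C_Kⁿ`.  By the existence theorem (7.8) the norm groups are exactly the
open (= closed) subgroups of finite index of `C_K`, so the *non-Galois-theoretic content* of this
half of (7.12) is the statement proved here: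

* `IdeleClassGroup.forall_exists_pow_eq_of_forall_mem` — **if an idele class `a` lies in every
  open subgroup of finite index of `C_K`, then `a` is an `n`-th power for every `n ≥ 1`.**

(`K : Type`, universe `0`, as the tree's idele class group API `IdeleClassGroup`, `posRealIdele`,
`AdelicGroupData`.)  It is hypothesis (b) of the glue
`GaloisRepresentations.exists_isGlobalReciprocityMap_of`
(`GaloisRepresentations/GlobalReciprocityProofs.lean`), which derives the global reciprocity law
`exists_isGlobalReciprocityMap K` from (a) the Artin map in limit form and (b).

## The proof (Neukirch p. 183, rearranged so as to need neither `I_K = I_K^S Kˣ` nor local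
`n`-th power indices)

Neukirch shows `D_K ⊆ C_Kⁿ Ū_K^S` (a norm group, (7.7) Addendum) and `⋂_S C_Kⁿ Ū_K^S = C_Kⁿ`
(`Ū_K^S → 1`, `C_Kⁿ = (C_K⁰)ⁿ × Γ_K` closed by (7.4) and the compactness (7.6) of `C_K⁰`).  We run
the same argument with the open subgroups of finite index produced directly by compactness:

1. `ℝ₊ˣ ↪ C_K` (`posReal`, the classes of the positive real ideles `z(r)`) is divisible, hence lies
   in every subgroup of finite index and in `C_Kⁿ`; as `C_K = C_K¹ · ℝ₊ˣ` ((7.4),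
   `exists_normOne_mul_posRealIdele`) we may assume `a ∈ C_K¹`.
2. For every open subgroup `W ≤ 𝕀_K`, `N_W = C_Kⁿ · W̄` is open, and of finite index: `C_K ⧸ N_W`
   is discrete and is the image of the compact `C_K¹` ((7.6), `isCompact_normOne_holds`).  So
   `a ∈ C_Kⁿ · W̄`.
3. Take `W = W(𝔫) = {x | x_∞ ∈ K_{∞,+}ˣ, x_f ∈ K_f(𝔫)}` for an ideal `𝔫 ≠ 0`, where `K_{∞,+}ˣ`
   (positive at the real places) is open and consists of `n`-th powers, and `K_f(𝔫)` is the
   principal congruence subgroup of `𝕀_{K,f}`; these come from the tree's `GL_n(𝔸_K)` level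
   structure with `n = 1` (`finitePrincipalCongruenceLevel`, `GLn.toMixed`, `GLn.ofInfinite`,
   `GLn.ofFinite`), transported along `𝕀_K ≃ₜ* GL₁(𝔸_K)`
   (`FramedRep.unitsContinuousMulEquivOfUnique`).  Then `a = bⁿ · [k]` with `k ∈ K(𝔫) = {1} × K_f(𝔫)`
   of idelic norm `1`; writing `b = b₁ [z(ρ)]`, `b₁ ∈ C_K¹`, norms give `[z(ρ)]ⁿ = 1`
   (`C_K¹ ∩ ℝ₊ˣ = 1`), so `a ∈ (C_K¹)ⁿ · [K(𝔫)]`.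
4. `(C_K¹)ⁿ` is compact, hence closed (`C_K` is Hausdorff), and the `K(𝔫)` shrink to `1`
   (`exists_principalCongruenceLevel_subset`): `a ∈ \overline{(C_K¹)ⁿ} = (C_K¹)ⁿ ⊆ C_Kⁿ`.

## References

* J. Neukirch, *Class Field Theory — The Bonn Lectures* (ed. A. Schmidt), Springer 2013, Part III
  Thm. (7.12) and its proof (p. 183 of the held copy), with (7.4), (7.6), (7.7) Addendum, (7.8).
  [Neukirch2013]
* J. W. S. Cassels, A. Fröhlich (eds.), *Algebraic Number Theory* (1967), Ch. II §§16–18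
  (topology of `J_K`, compactness of `J_K¹/Kˣ`). [CasselsFrohlichANT1967]
-/

noncomputable section

open NumberField IsDedekindDomain NumberField.mixedEmbedding NumberField.InfinitePlace Topology
open scoped NNReal

namespace Literature.NumberTheory.Automorphic

open GaloisRepresentations (ideleGroup principalIdeles)

/-! ### Generalities: divisible elements and finite-index subgroups -/

/-- In a commutative group, an infinitely divisible element lies in every subgroup of finite
index (`x = y^{(G:N)} ∈ N`). [folklore] -/
theorem mem_of_finiteIndex_of_forall_exists_pow {G : Type*} [CommGroup G] (N : Subgroup G)
    [N.FiniteIndex] {x : G} (hx : ∀ n : ℕ, 0 < n → ∃ y : G, y ^ n = x) : x ∈ N := by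
  obtain ⟨y, rfl⟩ := hx N.index (Nat.pos_of_ne_zero Subgroup.FiniteIndex.index_ne_zero)
  exact N.pow_index_mem y

/-- `ℝ₊ˣ = ℝ≥0ˣ` is divisible: `r = (r^{1/n})ⁿ`. [folklore] -/
theorem exists_units_pow_eq_nnreal (r : ℝ≥0ˣ) {n : ℕ} (hn : 0 < n) : ∃ s : ℝ≥0ˣ, s ^ n = r := by
  have hs0 : (r : ℝ≥0) ^ ((n : ℝ)⁻¹) ≠ 0 :=
    (NNReal.rpow_pos (pos_iff_ne_zero.mpr r.ne_zero)).ne'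
  refine ⟨Units.mk0 _ hs0, Units.ext ?_⟩
  rw [Units.val_pow_eq_pow_val, Units.val_mk0, NNReal.rpow_inv_natCast_pow _ hn.ne']

variable (K : Type) [Field K] [NumberField K]

namespace IdeleClassGroup

/-- The class `[z(r)] ∈ C_K` of a positive real idele is infinitely divisible (`z` is a
homomorphism `ℝ₊ˣ → 𝕀_K` and `ℝ₊ˣ` is divisible): Neukirch's "`Γ_K ≅ ℝ₊ˣ` consists of infinitely
divisible elements" (proof of III (7.12)). [cite: Neukirch2013, Part III Thm. (7.12) (proof)] -/
theorem exists_pow_eq_mk_posRealIdele (r : ℝ≥0ˣ) {n : ℕ} (hn : 0 < n) :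
    ∃ y : IdeleClassGroup K,
      y ^ n = ((posRealIdele K r : ideleGroup K) : IdeleClassGroup K) := by
  obtain ⟨s, rfl⟩ := exists_units_pow_eq_nnreal r hn
  exact ⟨((posRealIdele K s : ideleGroup K) : IdeleClassGroup K),
    by rw [map_pow, QuotientGroup.mk_pow]⟩

/-- Elements of `posReal K = ℝ₊ˣ Kˣ/Kˣ` are infinitely divisible. [folklore] -/
theorem exists_pow_eq_of_mem_posReal {x : IdeleClassGroup K} (hx : x ∈ posReal K) {n : ℕ}
    (hn : 0 < n) : ∃ y : IdeleClassGroup K, y ^ n = x := by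
  obtain ⟨_, ⟨r, rfl⟩, rfl⟩ := hx
  exact exists_pow_eq_mk_posRealIdele K r hn

/-- `ℝ₊ˣ ≤ N` for every subgroup `N ≤ C_K` of finite index. [folklore] -/
theorem posReal_le_of_finiteIndex (N : Subgroup (IdeleClassGroup K)) [N.FiniteIndex] :
    posReal K ≤ N := fun x hx =>
  mem_of_finiteIndex_of_forall_exists_pow (G := IdeleClassGroup K) N (x := x)
    fun _ hn => exists_pow_eq_of_mem_posReal K hx hn

end IdeleClassGroup

/-! ### The archimedean factor: positive units of the mixed space are `n`-th powers -/

/-- **An open subgroup of `(ℝ^{r₁} × ℂ^{r₂})ˣ` consisting of `n`-th powers for every `n ≥ 1`**: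
the units which are positive at the real places (`ℝ₊ˣ` and `ℂˣ` are divisible).  This is the
archimedean input `K_{∞,+}ˣ ⊆ (K_∞ˣ)ⁿ` of Neukirch's proof of III (7.12) (there hidden in
`Γ_K ⊆ C_Kⁿ` and in the openness of `C_Kⁿ Ū_K^S`). [folklore] -/
theorem exists_openSubgroup_mixedSpace_units_pow :
    ∃ P : Subgroup (mixedSpace K)ˣ, IsOpen (P : Set (mixedSpace K)ˣ) ∧
      ∀ u ∈ P, ∀ n : ℕ, 0 < n → ∃ v : (mixedSpace K)ˣ, v ^ n = u := by
  -- positivity at the real places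
  let P : Subgroup (mixedSpace K)ˣ :=
    { carrier := {u | ∀ w, 0 < ((u : (mixedSpace K)ˣ) : mixedSpace K).1 w}
      mul_mem' := fun {u u'} hu hu' w => by
        change 0 < ((u * u' : (mixedSpace K)ˣ) : mixedSpace K).1 w
        rw [Units.val_mul, Prod.fst_mul, Pi.mul_apply]
        exact mul_pos (hu w) (hu' w)
      one_mem' := fun w => by
        change (0 : ℝ) < ((1 : (mixedSpace K)ˣ) : mixedSpace K).1 w
        rw [Units.val_one, Prod.fst_one, Pi.one_apply]
        exact one_pos
      inv_mem' := fun {u} hu w => by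
        change 0 < ((u⁻¹ : (mixedSpace K)ˣ) : mixedSpace K).1 w
        have h1 : ((u : mixedSpace K).1 w) * (((u⁻¹ : (mixedSpace K)ˣ) : mixedSpace K).1 w) = 1 := by
          rw [← Pi.mul_apply, ← Prod.fst_mul, Units.mul_inv, Prod.fst_one, Pi.one_apply]
        exact (mul_pos_iff_of_pos_left (hu w)).mp (h1.symm ▸ one_pos) }
  have hmem : ∀ u : (mixedSpace K)ˣ, u ∈ P ↔ ∀ w, 0 < ((u : (mixedSpace K)ˣ) : mixedSpace K).1 w :=
    fun u => Iff.rfl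
  refine ⟨P, ?_, fun u hu n hn => ?_⟩
  · -- openness: finitely many open conditions on continuous coordinates
    have hP : (P : Set (mixedSpace K)ˣ) =
        ⋂ w, (fun u : (mixedSpace K)ˣ => ((u : mixedSpace K).1 w)) ⁻¹' Set.Ioi 0 := by
      ext u
      simp only [SetLike.mem_coe, hmem, Set.mem_iInter, Set.mem_preimage, Set.mem_Ioi]
    rw [hP]
    exact isOpen_iInter_of_finite fun w =>
      isOpen_Ioi.preimage (((continuous_apply w).comp continuous_fst).comp Units.continuous_val)
  · -- `n`-th roots: real coordinates are positive, complex coordinates are nonzero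
    have hu' := (hmem u).mp hu
    have hne : ∀ w, (u : mixedSpace K).2 w ≠ 0 := fun w h0 => by
      have h1 : ((u : mixedSpace K).2 w) * (((u⁻¹ : (mixedSpace K)ˣ) : mixedSpace K).2 w) = 1 := by
        rw [← Pi.mul_apply, ← Prod.snd_mul, Units.mul_inv, Prod.snd_one, Pi.one_apply]
      rw [h0, zero_mul] at h1
      exact zero_ne_one h1
    -- the root, as an element of the mixed space
    set f : mixedSpace K := (fun w => ((u : mixedSpace K).1 w) ^ ((n : ℝ)⁻¹),
      fun w => ((u : mixedSpace K).2 w) ^ ((n : ℂ)⁻¹)) with hf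
    have hfn : f ^ n = (u : mixedSpace K) := by
      refine Prod.ext (funext fun w => ?_) (funext fun w => ?_)
      · rw [Prod.pow_fst, Pi.pow_apply, hf]
        exact Real.rpow_inv_natCast_pow (hu' w).le hn.ne'
      · rw [Prod.pow_snd, Pi.pow_apply, hf]
        exact Complex.cpow_nat_inv_pow _ hn.ne'
    have hfu : IsUnit f := (isUnit_pow_iff hn.ne').mp (hfn ▸ u.isUnit)
    refine ⟨hfu.unit, Units.ext ?_⟩
    rw [Units.val_pow_eq_pow_val, IsUnit.unit_spec, hfn]

/-! ### Transport `𝕀_K ≃ₜ* GL₁(𝔸_K)` and the idelic norm of `K(𝔫)` -/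

/-- The underlying adele of `E⁻¹ g` for the transport `E : 𝕀_K ≃ₜ* GL₁(𝔸_K)`
(`FramedRep.unitsContinuousMulEquivOfUnique`) is the matrix entry `g₀₀` (definitional). [folklore] -/
theorem coe_unitsContinuousMulEquivOfUnique_symm (g : GL (Fin 1) (AdeleRing (𝓞 K) K)) :
    (((GaloisRepresentations.FramedRep.unitsContinuousMulEquivOfUnique (Fin 1)
        (AdeleRing (𝓞 K) K)).symm g : ideleGroup K) : AdeleRing (𝓞 K) K) =
      (g : Matrix (Fin 1) (Fin 1) (AdeleRing (𝓞 K) K)) 0 0 := rfl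

/-- **Elements of the integral level `K^max = {1} × GL₁(𝒪̂_K)` have idelic norm `1`**: their
archimedean component is `1` and their finite components are local units
(`mem_glIntegralLevel_iff'`, `mem_unitIdeles_iff_mem_and_inv_mem`).  Cassels–Fröhlich, Ch. II
§16 (the content of a unit idele). [folklore] -/
theorem ideleNorm_symm_eq_one_of_mem_glIntegralLevel {g : GL (Fin 1) (AdeleRing (𝓞 K) K)}
    (hg : g ∈ glIntegralLevel 1 K) :
    IdeleClassGroup.ideleNorm K
      ((GaloisRepresentations.FramedRep.unitsContinuousMulEquivOfUnique (Fin 1)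
        (AdeleRing (𝓞 K) K)).symm g) = 1 := by
  set E := GaloisRepresentations.FramedRep.unitsContinuousMulEquivOfUnique (Fin 1)
    (AdeleRing (𝓞 K) K) with hE
  obtain ⟨⟨h₁, h₂⟩, h₃⟩ := mem_glIntegralLevel_iff'.mp hg
  -- finite components are units
  have hunit : E.symm g ∈ GaloisRepresentations.unitIdeles K := by
    rw [GaloisRepresentations.mem_unitIdeles_iff_mem_and_inv_mem]
    refine ⟨fun v => ?_, fun v => ?_⟩
    · rw [coe_unitsContinuousMulEquivOfUnique_symm]
      exact h₁ 0 0 v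
    · rw [← map_inv, coe_unitsContinuousMulEquivOfUnique_symm]
      exact h₂ 0 0 v
  rw [ideleNorm_apply]
  have harch : ∀ w : InfinitePlace K,
      ‖((E.symm g : ideleGroup K) : AdeleRing (𝓞 K) K).1 w‖₊ ^ w.mult = 1 := fun w => by
    rw [coe_unitsContinuousMulEquivOfUnique_symm, h₃ 0 0, Matrix.one_apply_eq]
    change ‖(1 : w.Completion)‖₊ ^ w.mult = 1
    rw [nnnorm_one, one_pow]
  have hfin : ∀ v : HeightOneSpectrum (𝓞 K),
      ‖((E.symm g : ideleGroup K) : AdeleRing (𝓞 K) K).2 v‖₊ = 1 := fun v => by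
    apply NNReal.eq
    change ‖((E.symm g : ideleGroup K) : AdeleRing (𝓞 K) K).2 v‖ = 1
    rw [FinitePlace.norm_def, GaloisRepresentations.mem_unitIdeles_iff.mp hunit v, map_one,
      NNReal.coe_one]
  rw [Finset.prod_eq_one fun w _ => harch w, finprod_eq_one_of_forall_eq_one hfin, mul_one]

/-! ### The theorem -/

namespace IdeleClassGroup

/-- **`⋂ {open subgroups of finite index of C_K} ⊆ ⋂ₙ C_Kⁿ`** (Neukirch, *Class Field Theory —
The Bonn Lectures*, Part III, Thm. (7.12), first half of the proof, with (7.8): the norm groups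
are the open subgroups of finite index, and `D_K = ⋂_L N_{L|K} C_L = ⋂ₙ C_Kⁿ`).  If the idele class
`a ∈ C_K` lies in every open subgroup of finite index, then `a` is an `n`-th power for every
`n ≥ 1`.  See the module docstring for the proof (compactness of `C_K¹`, divisibility of `ℝ₊ˣ`,
the open subgroups `C_Kⁿ · W̄(𝔫)`, and `K(𝔫) → 1`).
[cite: Neukirch2013, Part III Thm. (7.12) (proof, p. 183)] -/
theorem forall_exists_pow_eq_of_forall_mem {a : IdeleClassGroup K}
    (ha : ∀ N : Subgroup (IdeleClassGroup K), IsOpen (N : Set (IdeleClassGroup K)) →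
      N.FiniteIndex → a ∈ N)
    {n : ℕ} (hn : 0 < n) : ∃ b : IdeleClassGroup K, b ^ n = a := by
  haveI : T2Space (IdeleClassGroup K) := t2Space_ideleClassGroup_holds K
  -- Step 0: reduce to `a ∈ C_K¹`
  suffices hmain : ∀ a : IdeleClassGroup K, a ∈ normOne K →
      (∀ N : Subgroup (IdeleClassGroup K), IsOpen (N : Set (IdeleClassGroup K)) →
        N.FiniteIndex → a ∈ N) → ∃ b : IdeleClassGroup K, b ^ n = a by
    obtain ⟨a₁, ha₁, r, rfl⟩ := exists_normOne_mul_posRealIdele K a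
    obtain ⟨y, hy⟩ := exists_pow_eq_mk_posRealIdele K r hn
    obtain ⟨b₁, hb₁⟩ := hmain a₁ ha₁ fun N hN hfi => by
      have h := ha N hN hfi
      have hr : ((posRealIdele K r : ideleGroup K) : IdeleClassGroup K) ∈ N :=
        posReal_le_of_finiteIndex K N (posRealIdele_mem_posReal K r)
      simpa only [mul_inv_cancel_right] using N.mul_mem h (N.inv_mem hr)
    exact ⟨b₁ * y, by rw [← hb₁, ← hy]; exact mul_pow b₁ y n⟩
  intro a ha₁ ha
  -- notation
  set E := GaloisRepresentations.FramedRep.unitsContinuousMulEquivOfUnique (Fin 1)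
    (AdeleRing (𝓞 K) K) with hE
  set Em := GaloisRepresentations.FramedRep.unitsContinuousMulEquivOfUnique (Fin 1)
    (mixedSpace K) with hEm
  set τ : GL (Fin 1) (AdeleRing (𝓞 K) K) →* (mixedSpace K)ˣ :=
    Em.symm.toMonoidHom.comp (GLn.toMixed 1 K) with hτ
  have hτ_cont : Continuous τ := Em.symm.continuous.comp (GLn.continuous_toMixed 1 K)
  set π : ideleGroup K →* IdeleClassGroup K := QuotientGroup.mk' (principalIdeles K) with hπ
  have hπ_apply : ∀ x : ideleGroup K, π x = (x : IdeleClassGroup K) := fun x => rfl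
  -- the compact (hence closed) set `(C_K¹)ⁿ`
  set S : Set (IdeleClassGroup K) := (fun c => c ^ n) '' (normOne K : Set (IdeleClassGroup K))
    with hS
  have hSc : IsClosed S := ((isCompact_normOne_holds K).image (continuous_pow n)).isClosed
  suffices hcl : a ∈ closure S by
    rw [hSc.closure_eq] at hcl
    obtain ⟨b, -, hb⟩ := hcl
    exact ⟨b, hb⟩
  rw [mem_closure_iff_nhds]
  intro U hU
  -- a level `𝔫 ≠ 0` with `K(𝔫) ⊆ {g | a · [E⁻¹ g]⁻¹ ∈ U}`
  have hcont : Continuous fun g : GL (Fin 1) (AdeleRing (𝓞 K) K) =>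
      a * ((E.symm g : ideleGroup K) : IdeleClassGroup K)⁻¹ := by
    refine (continuous_const (y := a)).mul ?_
    exact Continuous.inv
      ((QuotientGroup.continuous_mk (N := principalIdeles K)).comp E.symm.continuous)
  have hU' : {g : GL (Fin 1) (AdeleRing (𝓞 K) K) |
      a * ((E.symm g : ideleGroup K) : IdeleClassGroup K)⁻¹ ∈ U} ∈
        𝓝 (1 : GL (Fin 1) (AdeleRing (𝓞 K) K)) := by
    have h1 : a * ((E.symm 1 : ideleGroup K) : IdeleClassGroup K)⁻¹ = a := by
      have h11 : ((E.symm 1 : ideleGroup K) : IdeleClassGroup K) = 1 := by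
        rw [map_one]; rfl
      rw [h11]
      exact (congrArg (a * ·) inv_one).trans (mul_one a)
    have hU₁ : U ∈ 𝓝 (a * ((E.symm 1 : ideleGroup K) : IdeleClassGroup K)⁻¹) := by
      rwa [h1]
    exact hcont.continuousAt.preimage_mem_nhds hU₁
  obtain ⟨𝔫, h𝔫, hKU⟩ := exists_principalCongruenceLevel_subset 1 K hU'
  -- the open subgroup `W(𝔫) = E⁻¹ {g | g_f ∈ K_f(𝔫), g_∞ positive at the real places}`
  obtain ⟨P, hPo, hPpow⟩ := exists_openSubgroup_mixedSpace_units_pow K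
  set T : Subgroup (GL (Fin 1) (AdeleRing (𝓞 K) K)) :=
    (finitePrincipalCongruenceLevel 1 K 𝔫).comap (GLn.sndHom 1 K) ⊓ P.comap τ with hT
  have hTo : IsOpen (T : Set (GL (Fin 1) (AdeleRing (𝓞 K) K))) := by
    rw [hT, Subgroup.coe_inf, Subgroup.coe_comap, Subgroup.coe_comap]
    exact (isClopen_preimage_sndHom_finitePrincipalCongruenceLevel 1 K h𝔫).2.inter
      (hPo.preimage hτ_cont)
  set W : Subgroup (ideleGroup K) := T.comap E.toMonoidHom with hW
  have hWo : IsOpen (W : Set (ideleGroup K)) := by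
    rw [hW, Subgroup.coe_comap]
    exact hTo.preimage E.continuous
  -- `N_W = C_Kⁿ · W̄` is open and of finite index
  set Pn : Subgroup (IdeleClassGroup K) :=
    (@powMonoidHom (IdeleClassGroup K) _ n).range with hPn
  have hR_le : posReal K ≤ Pn := fun x hx => by
    obtain ⟨y, hy⟩ := exists_pow_eq_of_mem_posReal K hx hn
    exact ⟨y, hy⟩
  set NW : Subgroup (IdeleClassGroup K) := Pn ⊔ W.map π with hNW
  have hNWo : IsOpen (NW : Set (IdeleClassGroup K)) := by
    refine Subgroup.isOpen_mono (le_sup_right : W.map π ≤ NW) ?_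
    rw [Subgroup.coe_map]
    exact QuotientGroup.isOpenMap_coe _ hWo
  have hNWfi : NW.FiniteIndex := by
    haveI : DiscreteTopology (IdeleClassGroup K ⧸ NW) := QuotientGroup.discreteTopology hNWo
    have huniv : (QuotientGroup.mk : IdeleClassGroup K → IdeleClassGroup K ⧸ NW) ''
        (normOne K : Set (IdeleClassGroup K)) = Set.univ := by
      refine Set.eq_univ_of_forall fun q => ?_
      induction q using QuotientGroup.induction_on with
      | H c =>
        obtain ⟨c₁, hc₁, r, rfl⟩ := exists_normOne_mul_posRealIdele K c
        refine ⟨c₁, hc₁, ?_⟩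
        rw [QuotientGroup.eq, inv_mul_cancel_left]
        exact (le_sup_left : Pn ≤ NW) (hR_le (posRealIdele_mem_posReal K r))
    haveI : CompactSpace (IdeleClassGroup K ⧸ NW) := isCompact_univ_iff.mp
      (huniv ▸ (isCompact_normOne_holds K).image QuotientGroup.continuous_mk)
    haveI : Finite (IdeleClassGroup K ⧸ NW) := finite_of_compact_of_discrete
    exact Subgroup.finiteIndex_of_finite_quotient
  -- so `a = p · [w]` with `p ∈ C_Kⁿ`, `w ∈ W(𝔫)`
  obtain ⟨p, hp, x, hx, hpx⟩ := Subgroup.mem_sup.mp (ha NW hNWo hNWfi)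
  obtain ⟨w, hw, rfl⟩ := Subgroup.mem_map.mp hx
  have hwT : E w ∈ T := hw
  obtain ⟨hwf, hwP⟩ := Subgroup.mem_inf.mp hwT
  have hB : GLn.ofFinite 1 K (GLn.sndHom 1 K (E w)) ∈ principalCongruenceLevel 1 K 𝔫 := hwf
  have hwP' : τ (E w) ∈ P := hwP
  -- the archimedean factor is an `n`-th power
  obtain ⟨v, hv⟩ := hPpow _ hwP' n hn
  have hA : GLn.ofInfinite 1 K (GLn.toMixed 1 K (E w)) = (GLn.ofInfinite 1 K (Em v)) ^ n := by
    have h := (Em.apply_symm_apply (GLn.toMixed 1 K (E w))).symm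
    rw [← map_pow, ← map_pow, hv]
    try exact congrArg (GLn.ofInfinite 1 K) h
  set y : ideleGroup K := E.symm (GLn.ofInfinite 1 K (Em v)) with hy
  set k : ideleGroup K := E.symm (GLn.ofFinite 1 K (GLn.sndHom 1 K (E w))) with hk
  have hw_eq : w = y ^ n * k := by
    apply E.injective
    rw [map_mul, map_pow, hy, hk, E.apply_symm_apply, E.apply_symm_apply, ← hA,
      GLn.ofInfinite_toMixed_mul_ofFinite_sndHom]
  -- `[k]` has norm `1`
  have hk1 : IdeleClassGroup.ideleNorm K k = 1 :=
    ideleNorm_symm_eq_one_of_mem_glIntegralLevel K (principalCongruenceLevel_le 1 K 𝔫 hB)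
  -- `p · [y]ⁿ = bⁿ`, `b = b₁ [z(ρ)]`, `b₁ ∈ C_K¹`
  obtain ⟨b, hb⟩ : ∃ b : IdeleClassGroup K, b ^ n = p * π y ^ n := by
    obtain ⟨p', rfl⟩ := hp
    exact ⟨p' * π y, mul_pow p' (π y) n⟩
  obtain ⟨b₁, hb₁, ρ, rfl⟩ := exists_normOne_mul_posRealIdele K b
  have ha_eq : a = b₁ ^ n *
      ((((posRealIdele K ρ : ideleGroup K) : IdeleClassGroup K)) ^ n * π k) := by
    rw [← hpx, hw_eq, map_mul, map_pow, ← mul_assoc, ← hb]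
    exact (congrArg (· * π k) (mul_pow b₁ _ n)).trans (mul_assoc _ _ _)
  -- norms: `[z(ρ)]ⁿ ∈ C_K¹ ∩ ℝ₊ˣ = 1`
  have hρ : (((posRealIdele K ρ : ideleGroup K) : IdeleClassGroup K)) ^ n = 1 := by
    have hmem : (((posRealIdele K ρ : ideleGroup K) : IdeleClassGroup K)) ^ n ∈
        normOne K ⊓ posReal K := by
      refine ⟨?_, pow_mem (posRealIdele_mem_posReal K ρ) n⟩
      have h1 : norm K a = 1 := mem_normOne_iff.mp ha₁
      rw [ha_eq, map_mul, map_mul, map_pow, mem_normOne_iff.mp hb₁, one_pow, one_mul,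
        hπ_apply, norm_mk, hk1, mul_one] at h1
      exact mem_normOne_iff.mpr h1
    have hbot := normOne_inf_posReal_eq_bot_holds K
    rw [normOne_inf_posReal_eq_bot] at hbot
    rw [hbot] at hmem
    exact hmem
  -- conclude: `b₁ⁿ = a [k]⁻¹ ∈ U ∩ (C_K¹)ⁿ`
  refine ⟨b₁ ^ n, ?_, b₁, hb₁, rfl⟩
  have hkU : a * ((E.symm (GLn.ofFinite 1 K (GLn.sndHom 1 K (E w))) : ideleGroup K) :
      IdeleClassGroup K)⁻¹ ∈ U := hKU hB
  rw [← hk, ← hπ_apply] at hkU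
  have hfin : a * (π k)⁻¹ = b₁ ^ n := by
    rw [ha_eq, hρ]
    exact (congrArg (fun t => b₁ ^ n * t * (π k)⁻¹) (one_mul (π k))).trans
      (mul_inv_cancel_right (b₁ ^ n) (π k))
  rw [hfin] at hkU
  exact hkU

end IdeleClassGroup

end Literature.NumberTheory.Automorphic
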